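import Literature.Computability.ImplicitComplexity.STAEncTuple
import Literature.Computability.ImplicitComplexity.SoftTypeAssignmentWords
import HarnessLib

/-!
# GMR08 completeness infrastructure, V: padded strings and nested string iteration

Support file 5 for the completeness half of
`Literature.Computability.ImplicitComplexity.STACapturesP` (GMR08 Thm. 3.9).

GMR08 obtains `P(|s|)` iterations of the transition term from a Church numeral `P(len s)`
(Lemma 3.6, polynomials `!ᵈN ⊸ N_{2d+1}`). The formalisation takes the shorter road of iterating
over the INPUT STRING ITSELF, nested: a string `s : S_m` iterates any boxed step function `|s|`
times (`s̲ F z →* F b₀ (⋯ (F bₖ z))`), so `K` nested iterations over the padded string give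
`(|s| + 2)^K` iterations — a polynomial dominating the running time `c·|s|^k + c` of the machine
times the length of its flat program (the file `STACompleteness` chooses `K`). The string is the
shared variable of the zone toolkit (`STAEncZone`); the step function at the core occurs ONCE in
the term (it is duplicated at run time by the iterations, not in the syntax), which is what lets
a LINEAR local resource sit there (the reservoir cell constructor of `STAEncInit`).

* `padT ≐ λs c z. c 1 (c 1 (s c z))`, `⊢ padT : S_m ⊸ S_{m+1}` (`HT.padT`: the three copies of
  `c` are one rank-3 multiplexor; `reduces_padT`);
* `ItP str j k g` — the `j`-fold nested iterator at binder depth `k` with core `g`: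
  `ItP 0 = g`, `ItP (j+1) = λx. pad s (λb. ItP j) x`; its typing `HTz.itP`
  (`g : D ⊸ D ⟹ ItP j : D ⊸ D`, the locals of `g` promoted `j(m+1)` times), the computation of
  the string substitution `ItP_substp_string`, and the run `reduces_app_itP`:
  `ItP j N →β* g^{(n+2)^j} N` once the string `s̲` (`|s| = n`) is plugged in;
* small tools: `HT.var_level` (`x : !ᵖA ⊢ x : !ᵖA`), `HT.raise_slot` (one more `!` on a slot, in
  place), `tySb_inst`, `reduces_encWord_apps` (`s̲ F Z →* F b₀ (⋯ (F bₖ Z))`).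

## References

* [GaboardiMarionRonchidellarocca2008] GMR08 §3.2 (strings `S_i`, iteration), Lemma 3.6,
  Thm. 3.9; M. Gaboardi, S. Ronchi Della Rocca, CSL 2007, LNCS 4646, §5 (the same simulation).
-/

namespace Literature.Computability.ImplicitComplexity

namespace STA

/-! ### Small typing tools -/

/-- The one-slot context `i : σ`. [folklore] -/
def Ctx.single (i : ℕ) (σ : SoftTy) : Ctx := fun j => if j = i then some σ else none

/-- `single_self` (bookkeeping). [folklore] -/
@[simp] theorem Ctx.single_self (i : ℕ) (σ : SoftTy) : Ctx.single i σ i = some σ := by simp [Ctx.single]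
/-- `single_ne` (bookkeeping). [folklore] -/
theorem Ctx.single_ne {i j : ℕ} (h : j ≠ i) (σ : SoftTy) : Ctx.single i σ j = none := by simp [Ctx.single, h]

/-- The one-slot context is a singleton context in the sense of `Ctx.IsSingleton`. [folklore] -/
theorem Ctx.isSingleton_single (i : ℕ) (σ : SoftTy) : (Ctx.single i σ).IsSingleton i σ :=
  ⟨Ctx.single_self i σ, fun _ hj => Ctx.single_ne hj σ⟩

/-- Promoting a one-slot context. [folklore] -/
theorem Ctx.single_bang (i : ℕ) (σ : SoftTy) : (Ctx.single i σ).bang = Ctx.single i σ.bang := by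
  funext j; by_cases h : j = i <;> simp [Ctx.single, Ctx.bang, h]

/-- **A variable at a modal type**: `x : !ᵖA ⊢ x : !ᵖA` (the axiom followed by `p` promotions).
[cite: GaboardiMarionRonchidellarocca2008, Table 2 ((Ax), (sp))] -/
theorem HT.var_level {r : ℕ} (i p : ℕ) (A : LinTy) : HT r (Ctx.single i ⟨p, A⟩) (.var i) ⟨p, A⟩ := by
  induction p with
  | zero => exact HT.var (Ctx.isSingleton_single i _)
  | succ p ih =>
    have := ih.sp
    rwa [Ctx.single_bang] at this

/-- **Raising a slot by one `!` in place** (a rank-1 multiplexor to a fresh slot `t`, then the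
renaming back). [cite: GaboardiMarionRonchidellarocca2008, Table 2 (m)] -/
theorem HT.raise_slot {r : ℕ} (hr : 1 ≤ r) {Γ : Ctx} {M : Term} {σ : SoftTy} (h : HT r Γ M σ)
    {a t p : ℕ} {A : LinTy} (ha : Γ a = some ⟨p, A⟩) (ht : Γ t = none) :
    HT r (Function.update Γ a (some ⟨p + 1, A⟩)) M σ := by
  have hta : t ≠ a := fun e => by rw [e, ha] at ht; cases ht
  have h1 := h.mpx (σ := ⟨p, A⟩) {a} t (fun i hi => by rw [Finset.mem_singleton] at hi; subst hi; exact ha) ht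
    (by simpa using hr)
  let ρ : ℕ → ℕ := fun i => if i = t then a else i
  have hsupp : ∀ i, Γ.mpx {a} t ⟨p, A⟩ i ≠ none → (i ≠ a ∧ i ≠ t ∧ Γ i ≠ none) ∨ t = i := by
    intro i hi
    by_cases hit : i = t
    · exact Or.inr hit.symm
    · by_cases hia : i = a
      · subst hia; simp [Ctx.mpx] at hi
      · left; exact ⟨hia, hit, by simpa [Ctx.mpx, hia, hit] using hi⟩
  have hinj : (Γ.mpx {a} t ⟨p, A⟩).InjOn ρ := by
    intro i₁ i₂ hi₁ hi₂ he
    rcases hsupp i₁ hi₁ with ⟨h1a, h1t, -⟩ | rfl <;> rcases hsupp i₂ hi₂ with ⟨h2a, h2t, -⟩ | rfl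
    · simpa [ρ, h1t, h2t] using he
    · simp [ρ, h1t] at he; exact absurd he h1a
    · simp [ρ, h2t] at he; exact absurd he.symm h2a
    · rfl
  have h2 := h1.rename_ctx hinj
  have himg : (Γ.mpx {a} t ⟨p, A⟩).image ρ = Function.update Γ a (some ⟨p + 1, A⟩) := by
    refine Ctx.image_eq_of hinj (fun i hi => ?_) (fun i' hi' => ?_)
    · rcases hsupp i hi with ⟨hia, hit, -⟩ | rfl
      · have hρ : ρ i = i := by simp [ρ, hit]
        rw [hρ, Function.update_of_ne hia]
        simp [Ctx.mpx, hia, hit]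
      · have hρ : ρ t = a := by simp [ρ]
        rw [hρ, Function.update_self]
        simp [Ctx.mpx, hta, SoftTy.bang]
    · by_cases hia : i' = a
      · subst hia
        exact ⟨t, by simp [Ctx.mpx, hta], by simp [ρ]⟩
      · rw [Function.update_of_ne hia] at hi'
        have hit : i' ≠ t := fun e => by rw [e] at hi'; exact hi' ht
        exact ⟨i', by simpa [Ctx.mpx, hia, hit] using hi', by simp [ρ, hit]⟩
  rw [himg, Term.rename_rename] at h2
  have hM : M.rename (ρ ∘ mpxRen {a} t) = M := by
    refine Term.rename_eq_self_of_freeIn M fun i hi => ?_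
    have hne := h.isSome_of_freeIn hi
    have hit : i ≠ t := fun e => by rw [e] at hne; exact hne ht
    by_cases hia : i = a
    · subst hia; simp [ρ, mpxRen]
    · simp [ρ, mpxRen, hia, hit]
  rwa [hM] at h2

/-- Raising a slot to any higher level in place. [cite: GaboardiMarionRonchidellarocca2008, Table 2 (m)] -/
theorem HT.raise_slot_le {r : ℕ} (hr : 1 ≤ r) {Γ : Ctx} {M : Term} {σ : SoftTy} (h : HT r Γ M σ)
    {a t p : ℕ} {A : LinTy} (ha : Γ a = some ⟨p, A⟩) (ht : Γ t = none) {p' : ℕ} (hle : p ≤ p') :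
    HT r (Function.update Γ a (some ⟨p', A⟩)) M σ := by
  induction p', hle using Nat.le_induction with
  | base => rwa [Function.update_eq_self_iff.2 ha.symm]
  | succ p' _ ih =>
    have hta : t ≠ a := fun e => by rw [e, ha] at ht; cases ht
    have := ih.raise_slot hr (a := a) (t := t) (p := p') (A := A) (by rw [Function.update_self])
      (by rw [Function.update_of_ne hta]; exact ht)
    rwa [Function.update_idem] at this

/-! ### The string type instantiated -/

/-- The body `!ᵐ(B ⊸ α ⊸ α) ⊸ α ⊸ α` of `S_m = ∀α.(…)`. [cite: GaboardiMarionRonchidellarocca2008, §3.2] -/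
def tySb (m : ℕ) : LinTy := .limp m tyF (.limp 0 (.tvar 0) (.tvar 0))

/-- `tyS_eq` (bookkeeping). [folklore] -/
theorem tyS_eq (m : ℕ) : tyS m = .all (tySb m) := rfl

/-- `B` is closed under type substitution. [folklore] -/
theorem tyB_substp (θ : ℕ → LinTy) : tyB.substp θ = tyB := rfl

/-- `S_m` instantiated at `D`: `!ᵐ(B ⊸ D ⊸ D) ⊸ D ⊸ D`. [cite: GaboardiMarionRonchidellarocca2008, §3.2] -/
theorem tySb_inst (m : ℕ) (D : LinTy) :
    (tySb m).inst D = .limp m (.limp 0 tyB (.limp 0 D D)) (.limp 0 D D) := by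
  rw [LinTy.inst_eq_substp]
  rfl

/-! ### Iterating a string -/

/-- Substituting in the body of a word. [folklore] -/
theorem chainTo_one_substp (w : List Bool) (τ : ℕ → Term) :
    (chainTo 1 w).substp τ = w.foldr (fun b r => .app (.app (τ 1) (encBit b)) r) (τ 0) := by
  induction w with
  | nil => rfl
  | cons b w ih =>
    simp only [chainTo, List.foldr_cons, Term.substp] at ih ⊢
    rw [ih]
    cases b <;> rfl

/-- **String iteration**: `s̲ F Z →β* F b₀ (F b₁ (⋯ (F bₖ Z)⋯))`. [cite: GaboardiMarionRonchidellarocca2008, §3.2] -/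
theorem reduces_encWord_apps (w : List Bool) (F Z : Term) :
    Reduces ((encWord w).apps [F, Z]) (w.foldr (fun b r => .app (.app F (encBit b)) r) Z) := by
  rw [encWord_eq_chainTo]
  have := reduces_apps_lams 2 (chainTo 1 w) [F, Z] rfl
  rw [chainTo_one_substp] at this
  have e1 : Term.subL [F, Z] 1 = F := by simp [Term.subL]
  have e0 : Term.subL [F, Z] 0 = Z := by simp [Term.subL]
  rwa [e1, e0] at this

/-! ### Padding a string by two letters -/

/-- `padT ≐ λs.λc.λz. c 1 (c 1 (s c z))`: the string with two more letters in front.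
[cite: GaboardiMarionRonchidellarocca2008, §3.2] -/
def padT : Term :=
  Term.lams 3 (.app (.app (.var 1) one) (.app (.app (.var 1) one) (.app (.app (.var 2) (.var 1)) (.var 0))))

/-- `padT` is sum-free. [folklore] -/
theorem sumFree_padT : padT.SumFree := by
  simp [padT, Term.lams, Term.SumFree, one]

/-- `padT` is closed. [folklore] -/
theorem padT_closed (i : ℕ) : ¬padT.FreeIn i := by
  simp [padT, Term.lams, Term.FreeIn, one]

/-- **`padT s̲ F Z →β* F 1 (F 1 (s̲ F Z))`** (for any terms). [cite: GaboardiMarionRonchidellarocca2008, §3.2] -/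
theorem reduces_padT (S F Z : Term) :
    Reduces (padT.apps [S, F, Z]) (.app (.app F one) (.app (.app F one) (.app (.app S F) Z))) := by
  have := reduces_apps_lams 3
    (.app (.app (.var 1) one) (.app (.app (.var 1) one) (.app (.app (.var 2) (.var 1)) (.var 0)))) [S, F, Z] rfl
  have e2 : Term.subL [S, F, Z] 2 = S := by simp [Term.subL]
  have e1 : Term.subL [S, F, Z] 1 = F := by simp [Term.subL]
  have e0 : Term.subL [S, F, Z] 0 = Z := by simp [Term.subL]
  simp only [Term.substp, e2, e1, e0] at this
  exact this

/-- **`⊢ padT : S_m ⊸ S_{m+1}`** (rank `3`: the three copies of the iterator are one multiplexor).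
[cite: GaboardiMarionRonchidellarocca2008, §3.2, Table 2 (m)] -/
theorem HT.padT {r : ℕ} (hr : 3 ≤ r) (m : ℕ) : HT r Ctx.empty padT ⟨0, .limp 0 (tyS m) (tyS (m + 1))⟩ := by
  refine HT.lam (σ := ⟨0, tyS m⟩) (HT.allI ?_)
  have hsh : (Ctx.cons (some ⟨0, tyS m⟩) Ctx.empty).shift = Ctx.cons (some ⟨0, tyS m⟩) Ctx.empty := by
    rw [← Ctx.cons_shift]; rfl
  rw [hsh]
  refine HT.lam (σ := ⟨m + 1, tyF⟩) (HT.lam (σ := ⟨0, .tvar 0⟩) ?_)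
  -- the linear version with the three copies of `c` at slots 3, 4 (level 0) and 5 (level m)
  let Γ₁ : Ctx := fun j =>
    if j = 0 then some ⟨0, .tvar 0⟩ else if j = 2 then some ⟨0, tyS m⟩
    else if j = 3 then some ⟨0, tyF⟩ else if j = 4 then some ⟨0, tyF⟩ else if j = 5 then some ⟨m, tyF⟩ else none
  have hlin : HT r Γ₁ (.app (.app (.var 3) one) (.app (.app (.var 4) one) (.app (.app (.var 2) (.var 5)) (.var 0))))
      ⟨0, .tvar 0⟩ := by
    -- `s c₅ z`
    have hs : HT r (Ctx.single 2 ⟨0, tyS m⟩) (.var 2) ⟨0, .limp m tyF (.limp 0 (.tvar 0) (.tvar 0))⟩ := by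
      have := (HT.var_level (r := r) 2 0 (LinTy.all (tySb m))).allE (.tvar 0)
      rw [tySb_inst] at this
      exact this
    have hsc : HT r (fun j => if j = 2 then some ⟨0, tyS m⟩ else if j = 5 then some ⟨m, tyF⟩ else none)
        (.app (.var 2) (.var 5)) ⟨0, .limp 0 (.tvar 0) (.tvar 0)⟩ := by
      refine HT.app (Γ₁ := Ctx.single 2 ⟨0, tyS m⟩) (Γ₂ := Ctx.single 5 ⟨m, tyF⟩) (fun j => ?_) hs (HT.var_level 5 m tyF)
      by_cases h2 : j = 2
      · subst h2; left; simp [Ctx.single]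
      · by_cases h5 : j = 5
        · subst h5; right; simp [Ctx.single]
        · left; simp [Ctx.single, h2, h5]
    have hscz : HT r (fun j => if j = 0 then some ⟨0, .tvar 0⟩ else if j = 2 then some ⟨0, tyS m⟩
        else if j = 5 then some ⟨m, tyF⟩ else none) (.app (.app (.var 2) (.var 5)) (.var 0)) ⟨0, .tvar 0⟩ := by
      refine HT.app (Γ₂ := Ctx.single 0 ⟨0, .tvar 0⟩) (fun j => ?_) hsc (HT.var_level 0 0 (.tvar 0))
      by_cases h0 : j = 0
      · subst h0; right; simp [Ctx.single]
      · left; simp [Ctx.single, h0]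
    -- `c₄ 1 (…)`
    have hc4 : HT r (Ctx.single 4 ⟨0, tyF⟩) (.app (.var 4) one) ⟨0, .limp 0 (.tvar 0) (.tvar 0)⟩ :=
      (HT.var_level 4 0 tyF).app_arg_closed (by rw [tyB_eq_tyE, one_eq_oneHot]; exact HT.oneHot (by omega))
    have h4 : HT r (fun j => if j = 0 then some ⟨0, .tvar 0⟩ else if j = 2 then some ⟨0, tyS m⟩
        else if j = 4 then some ⟨0, tyF⟩ else if j = 5 then some ⟨m, tyF⟩ else none)
        (.app (.app (.var 4) one) (.app (.app (.var 2) (.var 5)) (.var 0))) ⟨0, .tvar 0⟩ := by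
      refine HT.app (Γ₁ := Ctx.single 4 ⟨0, tyF⟩) (fun j => ?_) hc4 hscz
      by_cases h4 : j = 4
      · subst h4; left; simp [Ctx.single]
      · right; simp [Ctx.single, h4]
    have hc3 : HT r (Ctx.single 3 ⟨0, tyF⟩) (.app (.var 3) one) ⟨0, .limp 0 (.tvar 0) (.tvar 0)⟩ :=
      (HT.var_level 3 0 tyF).app_arg_closed (by rw [tyB_eq_tyE, one_eq_oneHot]; exact HT.oneHot (by omega))
    refine HT.app (Γ₁ := Ctx.single 3 ⟨0, tyF⟩) (fun j => ?_) hc3 h4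
    by_cases h3 : j = 3
    · subst h3; left; simp [Ctx.single, Γ₁]
    · right; simp [Ctx.single, Γ₁, h3]
  -- raise the copies `3` and `4` to level `m` (fresh slot `6`)
  have h6 : Γ₁ 6 = none := by simp [Γ₁]
  have hr1 : 1 ≤ r := by omega
  have hlin₃ := hlin.raise_slot_le hr1 (a := 3) (t := 6) (p := 0) (A := tyF) (by simp [Γ₁]) h6 (Nat.zero_le m)
  have hlin₄ := hlin₃.raise_slot_le hr1 (a := 4) (t := 6) (p := 0) (A := tyF)
    (by rw [Function.update_of_ne (by norm_num)]; simp [Γ₁]) (by rw [Function.update_of_ne (by norm_num)]; exact h6)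
    (Nat.zero_le m)
  -- merge the three copies into slot `1`
  have hmpx := hlin₄.mpx (σ := ⟨m, tyF⟩) {3, 4, 5} 1 (fun i hi => by
      simp only [Finset.mem_insert, Finset.mem_singleton] at hi
      rcases hi with rfl | rfl | rfl
      · rw [Function.update_of_ne (by norm_num), Function.update_self]
      · rw [Function.update_self]
      · rw [Function.update_of_ne (by norm_num), Function.update_of_ne (by norm_num)]; simp [Γ₁])
    (by rw [Function.update_of_ne (by norm_num), Function.update_of_ne (by norm_num)]; simp [Γ₁])
    (by rw [Finset.card_insert_of_notMem (by simp), Finset.card_pair (by norm_num)]; exact hr)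
  convert hmpx using 2
  · funext j
    simp only [Ctx.mpx, Finset.mem_insert, Finset.mem_singleton]
    rcases j with _ | _ | _ | _ | _ | _ | j
    · simp [Ctx.cons, Γ₁]
    · simp [Ctx.cons, SoftTy.bang]
    · simp [Ctx.cons, Γ₁]
    · simp [Ctx.cons, Ctx.empty]
    · simp [Ctx.cons, Ctx.empty]
    · simp [Ctx.cons, Ctx.empty]
    · rw [Function.update_of_ne (by omega), Function.update_of_ne (by omega)]
      simp [Ctx.cons, Ctx.empty, Γ₁]
  · simp [Term.rename, mpxRen, one, Term.lams]

/-! ### The nested iterator -/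

/-- `ItP str j k g`: the `j`-fold nested string iterator at binder depth `k` around the core `g`
(a term at depth `k`): `ItP 0 = g`, `ItP (j+1) = λx. padT s (λb. ItP j) x` — the string `s` being
`str (k+1)` under the new binder `x` (`str = var`: the input string of the program `λs.…`;
`str = const s̲` once it is substituted), the inner iterator living two binders deeper.
[cite: GaboardiMarionRonchidellarocca2008, §3.2 (iteration), Thm. 3.9] -/
def ItP (str : ℕ → Term) : ℕ → ℕ → Term → Term
  | 0, _, g => g
  | j + 1, k, g => .lam (.app (.app (.app padT (str (k + 1))) (.lam (ItP str j (k + 2) (g.rename (· + 2))))) (.var 0))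

/-- `ItP` is sum-free when its core is. [folklore] -/
theorem sumFree_itP (str : ℕ → Term) (hstr : ∀ k, (str k).SumFree) :
    ∀ (j k : ℕ) (g : Term), g.SumFree → (ItP str j k g).SumFree
  | 0, _, _, hg => hg
  | j + 1, k, _, hg =>
    ⟨⟨⟨sumFree_padT, hstr _⟩, sumFree_itP str hstr j (k + 2) _ (hg.rename _)⟩, trivial⟩

/-- Promoting `cons none` commutes. [folklore] -/
theorem Ctx.iterate_bang_cons_none (n : ℕ) (L : Ctx) :
    Ctx.bang^[n] (Ctx.cons none L) = Ctx.cons none (Ctx.bang^[n] L) := by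
  induction n generalizing L with
  | zero => rfl
  | succ n ih =>
    rw [Function.iterate_succ_apply, Function.iterate_succ_apply, ← ih]
    congr 1
    rw [← Ctx.cons_bang]; rfl

/-- **Typing the nested iterator**: if the core is a step function `g : D ⊸ D` at depth `k` with
locals `L`, then `ItP j : D ⊸ D` with the locals of the core promoted `j · (m + 1)` times (each
level puts the inner iterator under the `!^{m+1}` box of the padded string's step argument) and
the string shared. [cite: GaboardiMarionRonchidellarocca2008, §3.2, Thm. 3.9] -/
theorem HTz.itP {r m : ℕ} (hr : 3 ≤ r) {D : LinTy} :
    ∀ (j k : ℕ) (L : Ctx) (g : Term), HTz r m k L g ⟨0, .limp 0 D D⟩ →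
      HTz r m k (Ctx.bang^[j * (m + 1)] L) (ItP Term.var j k g) ⟨0, .limp 0 D D⟩
  | 0, k, L, g, hg => by rw [Nat.zero_mul]; exact hg
  | j + 1, k, L, g, hg => by
    have hr2 : 2 ≤ r := by omega
    -- the core two binders deeper
    have hg2 : HTz r m (k + 2) (Ctx.cons none (Ctx.cons none L)) (g.rename (· + 2)) ⟨0, .limp 0 D D⟩ := by
      have := (hg.shift_succ none).shift_succ none
      rwa [Term.rename_rename] at this
    have ih := HTz.itP hr j (k + 2) _ _ hg2
    rw [Ctx.iterate_bang_cons_none, Ctx.iterate_bang_cons_none] at ih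
    -- `λb. ItP j` boxed `m + 1` times
    have hA : HTz r m (k + 1) (Ctx.cons none (Ctx.bang^[(j + 1) * (m + 1)] L))
        (.lam (ItP Term.var j (k + 2) (g.rename (· + 2)))) ⟨m + 1, .limp 0 tyB (.limp 0 D D)⟩ := by
      have h1 : HTz r m (k + 1) (Ctx.cons none (Ctx.bang^[j * (m + 1)] L))
          (.lam (ItP Term.var j (k + 2) (g.rename (· + 2)))) ⟨0, .limp 0 tyB (.limp 0 D D)⟩ := by
        refine HTz.lam (τ := ⟨0, tyB⟩) (ih.weakenL fun i _ hne => ?_)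
        rcases i with _ | _ | i
        · exact absurd rfl hne
        · rfl
        · rfl
      have h2 := h1.boxN (m + 1)
      rw [Ctx.iterate_bang_cons_none, ← Function.iterate_add_apply] at h2
      simpa [Nat.succ_mul, Nat.add_comm] using h2
    -- `padT s : S_{m+1}`, instantiated at `D`
    have hps : HTz r m (k + 1) (Ctx.cons none (Ctx.bang^[(j + 1) * (m + 1)] L)) (.app (.app padT (.var (k + 1)))
        (.lam (ItP Term.var j (k + 2) (g.rename (· + 2))))) ⟨0, .limp 0 D D⟩ := by
      have h1 : HTz r m (k + 1) (fun _ => none) (.app padT (.var (k + 1))) ⟨0, .all (tySb (m + 1))⟩ :=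
        HTz.app_closed_fun (HT.padT hr m) HTz.svar
      have h2 := h1.allE D
      rw [tySb_inst] at h2
      exact HTz.app hr2 (L₁ := fun _ => none) (fun i => Or.inr ⟨rfl, rfl⟩) h2 hA
    refine HTz.lam (τ := ⟨0, D⟩) ?_
    refine HTz.app hr2 (L₁ := Ctx.cons none (Ctx.bang^[(j + 1) * (m + 1)] L)) (L₂ := Ctx.cons (some ⟨0, D⟩) fun _ => none)
      (fun i => ?_) hps (HTz.lvar (by omega) rfl)
    cases i with
    | zero => exact Or.inr ⟨rfl, rfl⟩
    | succ i => exact Or.inl ⟨rfl, rfl⟩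

/-! ### Substituting the string -/

/-- Lifting past extra binders. [folklore] -/
theorem Term.up_iterate_add (σ : ℕ → Term) (k n i : ℕ) :
    (Term.up^[k + n] σ) (i + n) = ((Term.up^[k] σ) i).rename (· + n) := by
  induction n with
  | zero => simp [Term.rename_id']
  | succ n ih =>
    rw [← Nat.add_assoc k n 1, Function.iterate_succ_apply', ← Nat.add_assoc i n 1, Term.up_succ, ih,
      Term.rename_rename]
    rfl

/-- Renaming past `n` binders commutes with a substitution lifted past them. [folklore] -/
theorem Term.substp_rename_add (M : Term) (σ : ℕ → Term) (k n : ℕ) :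
    (M.rename (· + n)).substp (Term.up^[k + n] σ) = (M.substp (Term.up^[k] σ)).rename (· + n) := by
  rw [Term.substp_rename, Term.rename_substp]
  exact Term.substp_congr (fun i => Term.up_iterate_add σ k n i) M

/-- **Plugging the (closed) string into the iterator**: at depth `k` the program's string is
replaced by `s̲` and the core is substituted accordingly. [folklore] -/
theorem ItP_substp_string (S : Term) (hS : ∀ i, ¬S.FreeIn i) :
    ∀ (j k : ℕ) (g : Term), (ItP Term.var j k g).substp (Term.up^[k] (Term.consSub S)) =
      ItP (fun _ => S) j k (g.substp (Term.up^[k] (Term.consSub S)))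
  | 0, _, _ => rfl
  | j + 1, k, g => by
    have hpad : padT.substp (Term.up^[k + 1] (Term.consSub S)) = padT :=
      Term.substp_eq_self_of_freeIn _ fun i hi => absurd hi (padT_closed i)
    have hvar : (Term.up^[k + 1] (Term.consSub S)) (k + 1) = S := by
      rw [Term.up_iterate_consSub]
      simp only [lt_irrefl, if_false, if_true]
      exact Term.rename_eq_self_of_freeIn _ fun i hi => absurd hi (hS i)
    have h0 : (Term.up^[k + 1] (Term.consSub S)) 0 = .var 0 := by
      rw [Term.up_iterate_consSub, if_pos (by omega)]
    have e1 : Term.up (Term.up^[k] (Term.consSub S)) = Term.up^[k + 1] (Term.consSub S) :=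
      (Function.iterate_succ_apply' _ _ _).symm
    have e2 : Term.up (Term.up^[k + 1] (Term.consSub S)) = Term.up^[k + 2] (Term.consSub S) :=
      (Function.iterate_succ_apply' _ _ _).symm
    have ih := ItP_substp_string S hS j (k + 2) (g.rename (· + 2))
    simp only [ItP, Term.substp, e1, e2]
    rw [hpad, hvar, h0, ih, Term.substp_rename_add g (Term.consSub S) k 2]

/-- With a constant string the depth is irrelevant and substitutions go to the core. [folklore] -/
theorem ItP_const_substp (S : Term) (hS : ∀ i, ¬S.FreeIn i) :
    ∀ (j k k' : ℕ) (g : Term) (τ : ℕ → Term), (ItP (fun _ => S) j k g).substp τ = ItP (fun _ => S) j k' (g.substp τ)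
  | 0, _, _, _, _ => rfl
  | j + 1, k, k', g, τ => by
    simp only [ItP, Term.substp, Term.up_zero]
    have hpad : padT.substp (Term.up τ) = padT := Term.substp_eq_self_of_freeIn _ fun i hi => absurd hi (padT_closed i)
    have hSS : S.substp (Term.up τ) = S := Term.substp_eq_self_of_freeIn _ fun i hi => absurd hi (hS i)
    rw [hpad, hSS, ItP_const_substp S hS j (k + 2) (k' + 2) (g.rename (· + 2)) (Term.up (Term.up τ)),
      show Term.up (Term.up τ) = Term.up^[0 + 2] τ from rfl, Term.substp_rename_add g τ 0 2]
    rfl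

/-- With a constant string, renamings go to the core. [folklore] -/
theorem ItP_const_rename (S : Term) (hS : ∀ i, ¬S.FreeIn i) (j k k' : ℕ) (g : Term) (ρ : ℕ → ℕ) :
    (ItP (fun _ => S) j k g).rename ρ = ItP (fun _ => S) j k' (g.rename ρ) := by
  rw [Term.rename_eq_substp, ItP_const_substp S hS, ← Term.rename_eq_substp]

/-! ### Running the iterator -/

/-- `iterApp` composes. [folklore] -/
theorem iterApp_add (F Z : Term) (a b : ℕ) : iterApp F (iterApp F Z a) b = iterApp F Z (b + a) := by
  induction b with
  | zero => simp [iterApp]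
  | succ b ih => simp [iterApp, ih, Nat.succ_add]

/-- `iterApp_one` (bookkeeping). [folklore] -/
theorem iterApp_one (F Z : Term) : iterApp F Z 1 = .app F Z := rfl

/-- **The run of the nested iterator**: once the string `s̲` (`|s| = n`) is plugged in,
`ItP j N →β* g (g (⋯ (g N)))` with `(n + 2)^j` applications of the core.
[cite: GaboardiMarionRonchidellarocca2008, §3.2, Thm. 3.9] -/
theorem reduces_app_itP (w : List Bool) :
    ∀ (j k : ℕ) (g N : Term), Reduces (.app (ItP (fun _ => encWord w) j k g) N) (iterApp g N ((w.length + 2) ^ j))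
  | 0, _, g, N => by
    rw [pow_zero, iterApp_one]
    exact Relation.ReflTransGen.refl
  | j + 1, k, g, N => by
    have hS := encWord_closed w
    -- the outer β-step
    set A : Term := .lam (ItP (fun _ => encWord w) j (k + 2) (g.rename (· + 2))) with hA
    have hβ : Reduces (.app (ItP (fun _ => encWord w) (j + 1) k g) N)
        (.app (.app (.app padT (encWord w)) (A.subst0 N)) N) := by
      have := Red.beta (.app (.app (.app padT (encWord w)) A) (.var 0)) N
      simp only [Term.subst0_app, Term.subst0_var_zero] at this
      have hp : padT.subst0 N = padT := by
        rw [Term.subst0_eq_substp]; exact Term.substp_eq_self_of_freeIn _ fun i hi => absurd hi (padT_closed i)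
      have hs : (encWord w).subst0 N = encWord w := by
        rw [Term.subst0_eq_substp]; exact Term.substp_eq_self_of_freeIn _ fun i hi => absurd hi (hS i)
      rw [hp, hs] at this
      exact Relation.ReflTransGen.single this
    -- the substituted step function, and its application to any bit: back to `ItP j … g`
    have hA' : A.subst0 N = .lam (ItP (fun _ => encWord w) j k (g.rename Nat.succ)) := by
      rw [hA, Term.subst0_eq_substp]
      simp only [Term.substp]
      rw [ItP_const_substp _ hS j (k + 2) k, Term.substp_rename, Term.rename_eq_substp]
      rfl
    have hstep : ∀ X R : Term, Reduces (.app (.app (A.subst0 N) X) R) (.app (ItP (fun _ => encWord w) j k g) R) := by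
      intro X R
      rw [hA']
      refine Reduces.appL (Relation.ReflTransGen.single ?_) R
      have := Red.beta (ItP (fun _ => encWord w) j k (g.rename Nat.succ)) X
      rwa [Term.subst0_eq_substp, ItP_const_substp _ hS j k k, ← Term.subst0_eq_substp, Term.subst0_rename_succ] at this
    have ih := reduces_app_itP w j k g
    -- `m` applications of the step function iterate the core `m · (n+2)^j` times
    have hchain : ∀ (bs : List Bool) (R : Term),
        Reduces (bs.foldr (fun b r => .app (.app (A.subst0 N) (encBit b)) r) R)
          (iterApp g R (bs.length * (w.length + 2) ^ j)) := by
      intro bs R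
      induction bs with
      | nil =>
        show Reduces R (iterApp g R (([] : List Bool).length * _))
        rw [List.length_nil, Nat.zero_mul]
        exact Relation.ReflTransGen.refl
      | cons b bs ihb =>
        simp only [List.foldr_cons, List.length_cons]
        refine ((Reduces.appR _ ihb).trans (hstep _ _)).trans ?_
        rw [Nat.succ_mul, Nat.add_comm (bs.length * (w.length + 2) ^ j) ((w.length + 2) ^ j), ← iterApp_add]
        exact ih _
    -- assemble: pad, string iteration, and the two extra letters
    refine hβ.trans ((reduces_padT _ _ _).trans ?_)
    have hw : Reduces (.app (.app (encWord w) (A.subst0 N)) N)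
        (w.foldr (fun b r => .app (.app (A.subst0 N) (encBit b)) r) N) := reduces_encWord_apps w (A.subst0 N) N
    have h4 := hchain (true :: true :: w) N
    simp only [List.foldr_cons, List.length_cons] at h4
    refine (Reduces.appR _ (Reduces.appR _ hw)).trans ?_
    rw [show (w.length + 2) ^ (j + 1) = (w.length + 1 + 1) * (w.length + 2) ^ j by ring]
    exact h4

/-- **The nested iterator as a stack builder**: under its binder, `ItP (j+1)` reduces to the
`(n+2)^{j+1}`-fold application of its (shifted) core to the bound variable — with core `c blank`
this is a stack of that many blank cells (the reservoir of `STAEncInit`).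
[cite: GaboardiMarionRonchidellarocca2008, §3.2, Thm. 3.9] -/
theorem reduces_itP_succ_lam (w : List Bool) (j k : ℕ) (g : Term) :
    Reduces (ItP (fun _ => encWord w) (j + 1) k g) (.lam (iterApp (g.rename Nat.succ) (.var 0) ((w.length + 2) ^ (j + 1)))) := by
  have hS := encWord_closed w
  change Reduces (.lam (.app (.app (.app padT (encWord w))
    (.lam (ItP (fun _ => encWord w) j (k + 2) (g.rename (· + 2))))) (.var 0))) _
  refine Reduces.lam ?_
  set A : Term := .lam (ItP (fun _ => encWord w) j (k + 2) (g.rename (· + 2))) with hA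
  -- applying the step function to any bit gives back `ItP j` on the shifted core
  have hstep : ∀ X R : Term, Reduces (.app (.app A X) R) (.app (ItP (fun _ => encWord w) j (k + 2) (g.rename Nat.succ)) R) := by
    intro X R
    rw [hA]
    refine Reduces.appL (Relation.ReflTransGen.single ?_) R
    have := Red.beta (ItP (fun _ => encWord w) j (k + 2) (g.rename (· + 2))) X
    have e : (g.rename (· + 2)).substp (Term.consSub X) = g.rename Nat.succ := by
      rw [Term.substp_rename, Term.rename_eq_substp]
      exact Term.substp_congr (fun i => rfl) g
    rwa [Term.subst0_eq_substp, ItP_const_substp _ hS j (k + 2) (k + 2), e] at this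
  have ih := reduces_app_itP w j (k + 2) (g.rename Nat.succ)
  have hchain : ∀ (bs : List Bool) (R : Term),
      Reduces (bs.foldr (fun b r => .app (.app A (encBit b)) r) R)
        (iterApp (g.rename Nat.succ) R (bs.length * (w.length + 2) ^ j)) := by
    intro bs R
    induction bs with
    | nil =>
      show Reduces R (iterApp _ R (([] : List Bool).length * _))
      rw [List.length_nil, Nat.zero_mul]
      exact Relation.ReflTransGen.refl
    | cons b bs ihb =>
      simp only [List.foldr_cons, List.length_cons]
      refine ((Reduces.appR _ ihb).trans (hstep _ _)).trans ?_
      rw [Nat.succ_mul, Nat.add_comm (bs.length * (w.length + 2) ^ j) ((w.length + 2) ^ j), ← iterApp_add]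
      exact ih _
  refine (reduces_padT _ _ _).trans ?_
  have hw : Reduces (.app (.app (encWord w) A) (.var 0)) (w.foldr (fun b r => .app (.app A (encBit b)) r) (.var 0)) :=
    reduces_encWord_apps w A (.var 0)
  have h4 := hchain (true :: true :: w) (.var 0)
  simp only [List.foldr_cons, List.length_cons] at h4
  refine (Reduces.appR _ (Reduces.appR _ hw)).trans ?_
  rw [show (w.length + 2) ^ (j + 1) = (w.length + 1 + 1) * (w.length + 2) ^ j by ring]
  exact h4

end STA

end Literature.Computability.ImplicitComplexity
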